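import Summits.QuantumFields.BalabanUV.Beta.AveragingWardRooted
import Literature.MathematicalPhysics.QuantumFieldTheory.Balaban1983to89.Beta.AveragingWardStencils
import Summits.QuantumFields.BalabanUV.Beta.DiagonalContact

/-!
# `BalabanUV.Beta.AveragingWardRootedStencils` — node 8ρ, leaf 3 of 3: (K-V2)ρ THE BACKGROUND-BOND DIVERGENCE LAW OF THE
# ROOTED PRODUCT-CHART KERNEL («the contact moves with the root») and (S-V)ρ THE WARD LAW OF THE PACKED ROOTED STENCIL
# FAMILY `vhSAt ρ d L` IN BOTH PLACEMENTS (raw, as an2's `SpineRootedS0N.S0NAt` carries it; `mfNeg`-adapted, as `S₀`),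
# in an2's vocabulary `KernelWard.divV`, `ChartConjugation.conjV`, `BorderedHessian.diagK` — node 8b re-rooted, v1

HONEST FRAMING (page 1, mandatory).  This leaf belongs to the β sub-cell of the Bałaban audit, whose END STATEMENT is:
discharging the one-loop hypothesis `FlowStep.BetaPertH` makes Bałaban's ultraviolet stability theorem for 4-d lattice
Yang–Mills ([Balaban1989LargeFieldII], Thm. 1 p. 355) UNCONDITIONAL inside this package — a real constructive-QFT result;
it is NOT the continuum limit and NOT the Clay problem.  EVERYTHING below is kernel-proved [folklore] algebra of finite
letter lists and finite sums on `ℤ^d`; NOTHING is cited as a fact; B7 (11) («Ū^u = (Ū)^u», the gauge covariance of the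
averaging) is NOT asserted, at any order.  HONEST DEPENDENCY (cell records, verbatim): «continuum YM on T⁴ ⇐ BetaPertH ∧
nine spine estimates (0/9 proved); BetaPertH ⇐ (D1) ∧ (D4) ∧ CAP+tail; G-an2-4 gates asym, D1 and NE2/3/4.»  This leaf
is a DATUM for row D1's gauge binder (the (W1)/(W2)-type input of `Beta.KernelWard.ward_hess` for the vh-piece of the
rooted one-step spine); it is NOT `BetaPertH`.

ABSOLUTE RULE (cell charter, verbatim): «No internally-minted statement may enter as a cited fact. Every hypothesis is
either kernel-proved in this package or a verbatim quotation of a PUBLISHED theorem with page reference. The manuscript(s)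
under audit are NOT citable for their own disputed steps — they are the thing under adjudication; programme-internal
(2001/route/tribunal) claims are never citable.»  Accordingly NO declaration below is a `def … : Prop` carrying a
citation and no hypothesis of any theorem is a printed statement: every declaration is [folklore].

WHY THESE LEAVES (node 8ρ = `AveragingWardRooted` + `AveragingWardRootedKernels` + `AveragingWardRootedStencils`).
β-lead RULING (R26) P6c / (R28-2) name the an1-owed datum «averaging jets: background-gauge covariance at SECOND order»;
node 8 (`Beta.AveragingWardJets`) / node 8b (`Beta.AveragingWardStencils`) delivered it for the BASE-CORNER root `L·y`
of node 5.  RULING (R32) re-rooted the road's literal family at a generic offset (`ρ = ctr`, odd `L`, the centred system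
of [Balaban1987RG1] p.251): node 5ρ (`Beta.AveragingContoursRooted`), node 7aρ (`Beta.AveragingHessianKernelsRooted`),
and an2's ROOTED spine `SpineRootedS0N.S0NAt ρ cE cVH cΛ := cE • wilsonA + cVH • vhSAt ρ d Lc + cΛ • SLam …` (native
placement) now consume `vhSAt ρ`, NOT `vhS`.  Node 8ρ is the rooted twin of node 8 + node 8b: every theorem re-proved
ρ-generically by node 8's own scripts with the root `L·y` replaced by `r(y) = L·y + ρ`, the `ρ = 0` instances identified
with node 8 / node 8b BY NAME; split in three leaves by the tree's size lint (letters here; the kernel laws (K-H)ρ, (K-V1)ρ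
in `…Kernels`; the consumed law (K-V2)ρ and the stencil law (S-V)ρ in both placements in `…Stencils`).

WHAT IS TYPED HERE (`r = L·y + ρ`; fine sites `Fin (d+1) → ℤ`, colours `Fib d = Fin (d+1) ⊕ Fin (d+1)` in PART B):
* §1 (K-V2)ρ `vhCountAt_div_right : Σ_κ (vhCountAt ρ f (κ, z − e_κ) − vhCountAt ρ f (κ, z)) = 2L^d · ([r = z] − [f₋ = z]) ·
  linCountAt ρ f` and its real form `vhKerAt_div_right` (`1 ≤ L`) — THE CONTACT MOVES WITH THE ROOT: the multiplier leg of
  the coarse bond `(μ, y)` responds to the background gauge variation at the ROOT `L·y + ρ`, not at the corner `L·y`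
  (`decide`d toys: at `ρ = 1` the contact sits at `z = 1`, none at `z = 0`);
* §2 `linSymAt ρ L` = node 7a's packer applied to `q¹,ρ = linKerAt ρ` (`packVH_linKerAt`), symmetric, `linSymAt 0 = linSym`;
  the ACTION SITE of a leg `legSite ρ z b` (= `z` for a fluctuation leg `inl`, = `z + ρ` — the root — for a multiplier leg
  `inr` packed at the coarse image site `z`), the leg indicator `legInd ρ u z b = [legSite ρ z b = u]` (symbol of the
  DIAGONAL generator `diagK (legInd ρ u)`; `diagK (legInd 0 u) = siteP u`, node 8b's site projector);
* §3 the four colour blocks of `divV (vhSAt ρ d L) u` (`([z + ρ = u] − [x = u]) · linSymAt` on `(inl, inr)`,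
  `([x + ρ = u] − [z = u]) · linSymAt` on `(inr, inl)`, `0` on the diagonal blocks);
* §4 (S-V)ρ IN BOTH PLACEMENTS, entrywise and as a commutator with the diagonal generator:
  RAW `divV (vhSAt ρ d L) u = conjV (mfNeg (linSymAt ρ L)) (diagK (legInd ρ u))` (`divV_vhSAt_apply`, `divV_vhSAt_eq_conjV`,
  `divV_vhSAt_eq_comm`); ADAPTED `divV (fun κ′ v => mfNeg (vhSAt ρ d L rfl κ′ v)) u = conjV (linSymAt ρ L) (diagK (legInd ρ u))`
  (`divV_mfNeg_vhSAt`, `divV_mfNeg_vhSAt_eq_conjV`, `divV_mfNeg_vhSAt_eq_comm`); transversality away from the action sites;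
* §5 `ρ = 0`: node 8b's (S-V) `divV_mfNeg_vhS_eq_comm` recovered ON THE NOSE, and the raw base law `divV_vhS_apply`.
READING (informal, not used): under `B ↦ B + d(δ_u)` the rooted (V-H) stencil responds only by the generator of the gauge
rotation at `u` acting on its legs AT THEIR ACTION SITES, each time producing `q¹,ρ`.  With the symmetric (raw) placement
the generator pairs with the ANTISYMMETRISED first jet `mfNeg linSymAt`; with the adapted placement with `linSymAt` itself
— an algebraic fact recorded for the placement decision (R45-1), which this leaf does not pre-empt.

WHAT IS NOT PROVED / NOT CLAIMED: nothing printed (B7 (11) NOT asserted); nothing about the additive-chart twin `vhSaddAt`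
or the field–field packing `hessFFAt` in divergence form; nothing about `wilsonA` / `SLam`, `KInv`, `vertexOf`,
(W1′)/(W2′), the socket (Sr-conj), (R45), P6c as a hypothesis, (R1), (K1·), `BetaPertH`.

Provenance: cell pub-balaban, β sub-cell, lineage an1, gen 23 (2026-08-20), node 8ρ of the an1 plan; over node 8 (an1 gen 12),
node 5ρ / 7aρ (an1 gen 13/14) node 8b, and an2's `StepJetData` / `KernelWard` / `ChartConjugation` / `DiagonalContact` BY NAME; no existing file
touched.  Bib keys (locators only): Balaban1985Averaging, Balaban1987RG1, Balaban1989LargeFieldII.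
-/

open Finset
open Literature.MathematicalPhysics.QuantumFieldTheory.Balaban1983to89
open Literature.MathematicalPhysics.QuantumFieldTheory.Balaban1983to89.Beta
open AffineAveraging AveragingContours TransportedContourVariables AveragingHessianKernels AveragingWardJets
  AveragingContoursRooted AveragingHessianKernelsRooted
open Summit.QuantumFields.BalabanUV.Beta.AveragingWardRooted

namespace Summit.QuantumFields.BalabanUV.Beta.AveragingWardRootedStencils

/-! # PART A — (K-V2)ρ, letter / kernel flavour -/

section Kernel

variable {d : ℕ}

/-- [folklore] **(K-V2)ρ BACKWARD-DIVERGENCE LAW OF THE ROOTED PRODUCT-CHART KERNEL in its BACKGROUND bond**: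
`Σ_κ (vhCountAt ρ f (κ, z − e_κ) − vhCountAt ρ f (κ, z)) = 2L^d · ([r = z] − [f₋ = z]) · linCountAt ρ f` — THE CONTACT SITS
AT THE ROOT `r = L·y + ρ` (sign: the kernel is the coefficient of `[W_f, B_{f′}]` with the fluctuation letter FIRST). -/
theorem vhCountAt_div_right (ρ : Fin d → ℤ) (L : ℕ) (μ : Fin d) (y : Fin d → ℤ) (f : Bond d) (z : Fin d → ℤ) :
    ∑ κ : Fin d, (vhCountAt ρ L μ y f (κ, z - unitVec κ) - vhCountAt ρ L μ y f (κ, z))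
      = 2 * (L : ℤ) ^ d
        * (((if (L : ℤ) • y + ρ = z then 1 else 0) - (if f.2 = z then 1 else 0)) * linCountAt ρ L μ y f) := by
  simp only [vhCountAt_eq_skewVHAt, ← skewVHAt_sub_right, ← skewVHAt_sum_right, ← grad_siteδ, skewVHAt_grad_right,
    iniF_mulZ_siteδ, linAvgAt_single, siteδ_apply, AddMonoidHom.mul_apply, smul_eq_mul]
  rw [show linAvgAt ρ (δ1 f) L μ y = linCountAt ρ L μ y f from rfl]
  ring

/-- [folklore] **(K-V2)ρ for the REAL rooted kernel**: divergence in the background bond `= ([r = z] − [f₋ = z]) · q¹,ρ(f)`,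
`r = L·y + ρ` THE ROOT. -/
theorem vhKerAt_div_right {L : ℕ} (hL : 1 ≤ L) (ρ : Fin d → ℤ) (μ : Fin d) (y : Fin d → ℤ) (f : Bond d)
    (z : Fin d → ℤ) :
    ∑ κ : Fin d, (vhKerAt ρ L μ y f (κ, z - unitVec κ) - vhKerAt ρ L μ y f (κ, z))
      = ((if (L : ℤ) • y + ρ = z then 1 else 0) - (if f.2 = z then 1 else 0)) * linKerAt ρ L μ y f := by
  have hL' : (L : ℝ) ≠ 0 := by exact_mod_cast (show L ≠ 0 by omega)
  simp only [vhKerAt, linKerAt, ← sub_div, ← Finset.sum_div, ← Int.cast_sub, ← Int.cast_sum, vhCountAt_div_right]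
  push_cast
  field_simp
  ring

end Kernel

/-! ## DECIDED toy checks (`d = 1`, `L = 3`, `y = 0`, CENTRED ROOT `ρ = 1`: `r = 1`, `r + L = 4`; bonds `c_s = (0, s)`;
node 7aρ §10 tables: `linCountAt 1 = (0, 3, 3, 3, 0)` on `c₀…c₄`, `hessCountAt 1 (c_s, c_{s′}) = 3` for `1 ≤ s < s′ ≤ 3`,
`vhCountAt 1 (c₂, c₁) = vhCountAt 1 (c₃, c₁) = −18`) -/

section Toy

/-- (K-V2)ρ at the ROOT `z = 1`, `f = c₂`: `vhCountAt(c₂, c₀) − vhCountAt(c₂, c₁) = 0 − (−18) = 18 = 2·3·([1 = 1] − [2 = 1])·3`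
(the base-corner law of node 8 would put the contact at `z = 0` instead). -/
example : ∑ κ : Fin 1, (vhCountAt (fun _ => 1) 3 0 (fun _ => 0) (0, fun _ => 2) (κ, (fun _ => (1 : ℤ)) - unitVec κ)
    - vhCountAt (fun _ => 1) 3 0 (fun _ => 0) (0, fun _ => 2) (κ, fun _ => 1)) = 18 := by decide

/-- (K-V2)ρ at the CORNER `z = 0`, `f = c₂`: no contact any more (`[r = 0] = 0`, `[f₋ = 0] = 0`). -/
example : ∑ κ : Fin 1, (vhCountAt (fun _ => 1) 3 0 (fun _ => 0) (0, fun _ => 2) (κ, (fun _ => (0 : ℤ)) - unitVec κ)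
    - vhCountAt (fun _ => 1) 3 0 (fun _ => 0) (0, fun _ => 2) (κ, fun _ => 0)) = 0 := by decide

end Toy

/-! # PART B — stencil flavour (fine sites `Fin (d+1) → ℤ`, colours `Fib d = Fin (d+1) ⊕ Fin (d+1)`;
an2's `KernelWard.divV`, `StepJetData.mfNeg`, `ChartConjugation.conjV`, `BorderedHessian.diagK`; node 8b's `linSym`, `siteP`) -/

noncomputable section

open ExpKernelCalculus (MKer comp)
open OneStepResolventKernel (Fib)
open StepJetData (mfNeg mfNeg_inl_inl mfNeg_inl_inr mfNeg_inr_inl mfNeg_inr_inr)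
open KernelWard (divV)
open AveragingWardStencils (b6UnitVec_eq linSym linSym_inl_inr linSym_inr_inl linSym_inl_inl linSym_inr_inr siteP
  siteP_apply divV_mfNeg divV_mfNeg_vhS)
open Summit.QuantumFields.BalabanUV.Beta.ChartConjugation (conjV)
open Summit.QuantumFields.BalabanUV.Beta.BorderedHessian (diagK diagK_apply conjV_diagK_apply)

variable {d : ℕ}

/-! ## §2 The rooted packed first-order kernel `linSymAt ρ`, the action site of a leg, the leg indicator -/

/-- [folklore] THE ROOTED SYMMETRICALLY PACKED FIRST-ORDER AVERAGING KERNEL (node 8b's `linSym` with `q¹ ↦ q¹,ρ =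
linKerAt ρ`): entry `((x, inl α), (z, inr μ)) ↦ q¹,ρ_{(μ, z/L)}((α, x))` when `z` is the fine image of a coarse site
(`off L z = 0`), else `0`; the symmetric twin on `(inr, inl)`; `0` on the diagonal blocks (node 7a's packer conventions,
`packVH_linKerAt`). -/
def linSymAt (ρ : Fin (d + 1) → ℤ) (L : ℕ) : MKer (d + 1) (Fib d) := fun x z a b =>
  match a, b with
  | Sum.inl α, Sum.inr μ => if off L z = 0 then linKerAt ρ L μ (blk L z) (α, x) else 0
  | Sum.inr μ, Sum.inl α => if off L x = 0 then linKerAt ρ L μ (blk L x) (α, z) else 0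
  | Sum.inl _, Sum.inl _ => 0
  | Sum.inr _, Sum.inr _ => 0

/-- [folklore] The `(inl, inr)` entries of `linSymAt ρ`. -/
@[simp] theorem linSymAt_inl_inr (ρ : Fin (d + 1) → ℤ) (L : ℕ) (x z : Fin (d + 1) → ℤ) (α μ : Fin (d + 1)) :
    linSymAt ρ L x z (Sum.inl α) (Sum.inr μ) = if off L z = 0 then linKerAt ρ L μ (blk L z) (α, x) else 0 := rfl

/-- [folklore] The `(inr, inl)` entries of `linSymAt ρ`. -/
@[simp] theorem linSymAt_inr_inl (ρ : Fin (d + 1) → ℤ) (L : ℕ) (x z : Fin (d + 1) → ℤ) (μ α : Fin (d + 1)) :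
    linSymAt ρ L x z (Sum.inr μ) (Sum.inl α) = if off L x = 0 then linKerAt ρ L μ (blk L x) (α, z) else 0 := rfl

/-- [folklore] `linSymAt ρ` vanishes on the field–field block. -/
@[simp] theorem linSymAt_inl_inl (ρ : Fin (d + 1) → ℤ) (L : ℕ) (x z : Fin (d + 1) → ℤ) (α α' : Fin (d + 1)) :
    linSymAt ρ L x z (Sum.inl α) (Sum.inl α') = 0 := rfl

/-- [folklore] `linSymAt ρ` vanishes on the multiplier–multiplier block. -/
@[simp] theorem linSymAt_inr_inr (ρ : Fin (d + 1) → ℤ) (L : ℕ) (x z : Fin (d + 1) → ℤ) (μ μ' : Fin (d + 1)) :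
    linSymAt ρ L x z (Sum.inr μ) (Sum.inr μ') = 0 := rfl

/-- [folklore] `linSymAt ρ` IS node 7a's packer applied to the rooted first-order kernel (background-bond slot ignored). -/
theorem packVH_linKerAt (ρ : Fin (d + 1) → ℤ) (L : ℕ) (κ' : Fin (d + 1)) (u : Fin (d + 1) → ℤ) :
    packVH (fun μ y f _ => linKerAt ρ L μ y f) L κ' u = linSymAt ρ L := by
  funext x z a b
  rcases a with α | μ <;> rcases b with α' | μ' <;> rfl

/-- [folklore] `linSymAt ρ` is symmetric. -/
theorem linSymAt_symm (ρ : Fin (d + 1) → ℤ) (L : ℕ) (x z : Fin (d + 1) → ℤ) (a b : Fib d) :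
    linSymAt ρ L x z a b = linSymAt ρ L z x b a := by
  rcases a with α | μ <;> rcases b with α' | μ' <;> rfl

/-- [folklore] `ρ = 0`: node 8b's `linSym`. -/
@[simp] theorem linSymAt_zero (L : ℕ) : linSymAt (0 : Fin (d + 1) → ℤ) L = linSym d L := by
  funext x z a b
  rcases a with α | μ <;> rcases b with α' | μ' <;> simp

/-- [folklore] THE ACTION SITE OF A LEG of the packed rooted stencil at the fine index `(z, b)`: a fluctuation leg
(`b = inl α`, letter `W_{(α, z)}`) is acted on by the background gauge rotation at its initial point `z`; a multiplier leg
(`b = inr μ`, the averaged variable of the coarse bond `(μ, z/L)`, packed at the fine image `z = L·(z/L)`) at the ROOT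
`z + ρ` of its rooted contours. -/
def legSite (ρ z : Fin (d + 1) → ℤ) : Fib d → (Fin (d + 1) → ℤ)
  | Sum.inl _ => z
  | Sum.inr _ => z + ρ

/-- [folklore] A fluctuation leg acts at its own index site. -/
@[simp] theorem legSite_inl (ρ z : Fin (d + 1) → ℤ) (α : Fin (d + 1)) : legSite ρ z (Sum.inl α) = z := rfl

/-- [folklore] A multiplier leg acts at the ROOT `z + ρ`. -/
@[simp] theorem legSite_inr (ρ z : Fin (d + 1) → ℤ) (μ : Fin (d + 1)) : legSite ρ z (Sum.inr μ) = z + ρ := rfl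

/-- [folklore] At `ρ = 0` every leg acts at its own index site. -/
@[simp] theorem legSite_zero (z : Fin (d + 1) → ℤ) (b : Fib d) : legSite 0 z b = z := by
  cases b <;> simp

/-- [folklore] THE LEG INDICATOR of the varied site `u`: `[legSite ρ z b = u]` — the symbol of the DIAGONAL generator
`diagK (legInd ρ u)` of the background gauge rotation at `u` acting on the legs of the rooted stencil (at `ρ = 0` it is
node 8b's site projector, `diagK_legInd_zero`). -/
def legInd (ρ u : Fin (d + 1) → ℤ) : (Fin (d + 1) → ℤ) → Fib d → ℝ := fun z b => if legSite ρ z b = u then 1 else 0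

/-- [folklore] The entries of the leg indicator. -/
theorem legInd_apply (ρ u z : Fin (d + 1) → ℤ) (b : Fib d) :
    legInd ρ u z b = if legSite ρ z b = u then 1 else 0 := rfl

/-- [folklore] The leg indicator on a fluctuation leg: `[z = u]`. -/
@[simp] theorem legInd_inl (ρ u z : Fin (d + 1) → ℤ) (α : Fin (d + 1)) :
    legInd ρ u z (Sum.inl α) = if z = u then 1 else 0 := rfl

/-- [folklore] The leg indicator on a multiplier leg: `[z + ρ = u]`. -/
@[simp] theorem legInd_inr (ρ u z : Fin (d + 1) → ℤ) (μ : Fin (d + 1)) :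
    legInd ρ u z (Sum.inr μ) = if z + ρ = u then 1 else 0 := rfl

/-- [folklore] `ρ = 0`: the diagonal generator with symbol `legInd 0 u` IS node 8b's site projector `siteP u`. -/
theorem diagK_legInd_zero (u : Fin (d + 1) → ℤ) : diagK (legInd 0 u) = siteP u := by
  funext x z a b
  simp only [diagK_apply, legInd_apply, legSite_zero, siteP_apply]
  by_cases hxu : x = u
  · by_cases hxz : x = z
    · have hzu : z = u := hxz.symm.trans hxu
      simp [hxu, hzu]
    · have hzu : ¬ z = u := fun h => hxz (hxu.trans h.symm)
      have huz : ¬ u = z := fun h => hzu h.symm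
      simp [hxu, hzu, huz]
  · simp [hxu]

/-! ## §3 The four colour blocks of `divV (vhSAt ρ d L) u` -/

/-- [folklore] **THE `(inl, inr)` BLOCK, rooted**: for the fluctuation leg `(α, x)` and the multiplier leg `(μ, z)`,
`Σ_κ′ (vhSAt ρ κ′ (u − e_κ′) − vhSAt ρ κ′ u)((x, inl α), (z, inr μ)) = ([z + ρ = u] − [x = u]) · q¹,ρ` — (K-V2)ρ
`vhKerAt_div_right` read through node 7a's packer: on the packer's support `z = L • blk L z`, so the root of the
multiplier leg's contours is `z + ρ`. -/
theorem divV_vhSAt_inl_inr {L : ℕ} (hL : 1 ≤ L) (ρ u x z : Fin (d + 1) → ℤ) (α μ : Fin (d + 1)) :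
    divV (vhSAt ρ d L) u x z (Sum.inl α) (Sum.inr μ)
      = ((if z + ρ = u then 1 else 0) - (if x = u then 1 else 0)) * linSymAt ρ L x z (Sum.inl α) (Sum.inr μ) := by
  simp only [KernelWard.divV, Finset.sum_apply, Pi.sub_apply, vhSAt, packVH_inl_inr, linSymAt_inl_inr]
  by_cases hz : off L z = 0
  · simp only [hz, if_true, b6UnitVec_eq]
    rw [vhKerAt_div_right hL, ← eq_smul_blk_of_off_eq_zero hL hz]
  · simp [hz]

/-- [folklore] **THE `(inr, inl)` BLOCK, rooted** (the packer's symmetric twin; legs exchanged, hence the opposite sign):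
`… ((x, inr μ), (z, inl α)) = ([x + ρ = u] − [z = u]) · q¹,ρ`. -/
theorem divV_vhSAt_inr_inl {L : ℕ} (hL : 1 ≤ L) (ρ u x z : Fin (d + 1) → ℤ) (μ α : Fin (d + 1)) :
    divV (vhSAt ρ d L) u x z (Sum.inr μ) (Sum.inl α)
      = ((if x + ρ = u then 1 else 0) - (if z = u then 1 else 0)) * linSymAt ρ L x z (Sum.inr μ) (Sum.inl α) := by
  simp only [KernelWard.divV, Finset.sum_apply, Pi.sub_apply, vhSAt, packVH_inr_inl, linSymAt_inr_inl]
  by_cases hx : off L x = 0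
  · simp only [hx, if_true, b6UnitVec_eq]
    rw [vhKerAt_div_right hL, ← eq_smul_blk_of_off_eq_zero hL hx]
  · simp [hx]

/-- [folklore] The divergence vanishes on the field–field block (so does `vhSAt ρ`). -/
theorem divV_vhSAt_inl_inl (ρ : Fin (d + 1) → ℤ) (L : ℕ) (u x z : Fin (d + 1) → ℤ) (α α' : Fin (d + 1)) :
    divV (vhSAt ρ d L) u x z (Sum.inl α) (Sum.inl α') = 0 := by
  simp [KernelWard.divV, Finset.sum_apply, vhSAt]

/-- [folklore] The divergence vanishes on the multiplier–multiplier block (so does `vhSAt ρ`). -/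
theorem divV_vhSAt_inr_inr (ρ : Fin (d + 1) → ℤ) (L : ℕ) (u x z : Fin (d + 1) → ℤ) (μ μ' : Fin (d + 1)) :
    divV (vhSAt ρ d L) u x z (Sum.inr μ) (Sum.inr μ') = 0 := by
  simp [KernelWard.divV, Finset.sum_apply, vhSAt]

/-! ## §4 (S-V)ρ The rooted stencil Ward law in BOTH placements, entrywise and as a commutator with the diagonal generator -/

/-- [folklore] **(S-V)ρ, RAW PLACEMENT (the vh-piece exactly as the rooted spine `SpineRootedS0N.S0NAt ρ …` carries it),
ENTRYWISE**: `divV (vhSAt ρ d L) u x z a b = (legInd ρ u z b − legInd ρ u x a) · mfNeg (linSymAt ρ L) x z a b` — with a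
SYMMETRIC placement of the second jet the contact multiplies the ANTISYMMETRISED first jet. -/
theorem divV_vhSAt_apply {L : ℕ} (hL : 1 ≤ L) (ρ u x z : Fin (d + 1) → ℤ) (a b : Fib d) :
    divV (vhSAt ρ d L) u x z a b = (legInd ρ u z b - legInd ρ u x a) * mfNeg (linSymAt ρ L) x z a b := by
  rcases a with α | μ <;> rcases b with α' | μ'
  · simp [divV_vhSAt_inl_inl]
  · rw [mfNeg_inl_inr, divV_vhSAt_inl_inr hL, legInd_inr, legInd_inl]
  · rw [mfNeg_inr_inl, divV_vhSAt_inr_inl hL, legInd_inl, legInd_inr]; ring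
  · simp [divV_vhSAt_inr_inr]

/-- [folklore] **(S-V)ρ, RAW PLACEMENT, COMMUTATOR FORM — the (W2) SHAPE**:
`divV (vhSAt ρ d L) u = conjV (mfNeg (linSymAt ρ L)) (diagK (legInd ρ u)) = mfNeg q¹,ρ ∘ D_u − D_u ∘ mfNeg q¹,ρ`, `D_u` the
diagonal generator acting on each leg at its action site. -/
theorem divV_vhSAt_eq_conjV {L : ℕ} (hL : 1 ≤ L) (ρ u : Fin (d + 1) → ℤ) :
    divV (vhSAt ρ d L) u = conjV (mfNeg (linSymAt ρ L)) (diagK (legInd ρ u)) := by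
  funext x z a b
  rw [conjV_diagK_apply, divV_vhSAt_apply hL]
  ring

/-- [folklore] The same with `conjV` expanded: `divV (vhSAt ρ d L) u = comp (mfNeg q¹,ρ) D_u − comp D_u (mfNeg q¹,ρ)`. -/
theorem divV_vhSAt_eq_comm {L : ℕ} (hL : 1 ≤ L) (ρ u : Fin (d + 1) → ℤ) :
    divV (vhSAt ρ d L) u
      = comp (mfNeg (linSymAt ρ L)) (diagK (legInd ρ u)) - comp (diagK (legInd ρ u)) (mfNeg (linSymAt ρ L)) := by
  rw [divV_vhSAt_eq_conjV hL]; rfl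

/-- [folklore] **(S-V)ρ, ADAPTED PLACEMENT (`mfNeg`, as the base-rooted `BalabanStep.S₀` carries node 7a's `vhS`),
ENTRYWISE**: `divV (mfNeg ∘∘ vhSAt ρ) u x z a b = (legInd ρ u z b − legInd ρ u x a) · linSymAt ρ L x z a b`. -/
theorem divV_mfNeg_vhSAt {L : ℕ} (hL : 1 ≤ L) (ρ u x z : Fin (d + 1) → ℤ) (a b : Fib d) :
    divV (fun κ' v => mfNeg (vhSAt ρ d L rfl κ' v)) u x z a b = (legInd ρ u z b - legInd ρ u x a) * linSymAt ρ L x z a b := by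
  rw [divV_mfNeg]
  rcases a with α | μ <;> rcases b with α' | μ'
  · simp [divV_vhSAt_inl_inl]
  · rw [mfNeg_inl_inr, divV_vhSAt_inl_inr hL, legInd_inr, legInd_inl]
  · rw [mfNeg_inr_inl, divV_vhSAt_inr_inl hL, legInd_inl, legInd_inr]; ring
  · simp [divV_vhSAt_inr_inr]

/-- [folklore] **(S-V)ρ, ADAPTED PLACEMENT, COMMUTATOR FORM — the (W2) SHAPE**:
`divV (mfNeg ∘∘ vhSAt ρ) u = conjV (linSymAt ρ L) (diagK (legInd ρ u)) = q¹,ρ ∘ D_u − D_u ∘ q¹,ρ`. -/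
theorem divV_mfNeg_vhSAt_eq_conjV {L : ℕ} (hL : 1 ≤ L) (ρ u : Fin (d + 1) → ℤ) :
    divV (fun κ' v => mfNeg (vhSAt ρ d L rfl κ' v)) u = conjV (linSymAt ρ L) (diagK (legInd ρ u)) := by
  funext x z a b
  rw [conjV_diagK_apply, divV_mfNeg_vhSAt hL]
  ring

/-- [folklore] The same with `conjV` expanded. -/
theorem divV_mfNeg_vhSAt_eq_comm {L : ℕ} (hL : 1 ≤ L) (ρ u : Fin (d + 1) → ℤ) :
    divV (fun κ' v => mfNeg (vhSAt ρ d L rfl κ' v)) u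
      = comp (linSymAt ρ L) (diagK (legInd ρ u)) - comp (diagK (legInd ρ u)) (linSymAt ρ L) := by
  rw [divV_mfNeg_vhSAt_eq_conjV hL]; rfl

/-- [folklore] **TRANSVERSALITY AWAY FROM THE ACTION SITES** (raw placement): if the varied site `u` is neither leg's action
site, the divergence entry vanishes. -/
theorem divV_vhSAt_eq_zero {L : ℕ} (hL : 1 ≤ L) {ρ u x z : Fin (d + 1) → ℤ} {a b : Fib d}
    (hz : legSite ρ z b ≠ u) (hx : legSite ρ x a ≠ u) : divV (vhSAt ρ d L) u x z a b = 0 := by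
  simp [divV_vhSAt_apply hL, legInd_apply, hz, hx]

/-- [folklore] The same for the adapted placement. -/
theorem divV_mfNeg_vhSAt_eq_zero {L : ℕ} (hL : 1 ≤ L) {ρ u x z : Fin (d + 1) → ℤ} {a b : Fib d}
    (hz : legSite ρ z b ≠ u) (hx : legSite ρ x a ≠ u) : divV (fun κ' v => mfNeg (vhSAt ρ d L rfl κ' v)) u x z a b = 0 := by
  simp [divV_mfNeg_vhSAt hL, legInd_apply, hz, hx]

/-- [folklore] Coarser sufficient condition, uniform in the colours: `u ∉ {z, z + ρ, x, x + ρ}`. -/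
theorem divV_vhSAt_eq_zero' {L : ℕ} (hL : 1 ≤ L) {ρ u x z : Fin (d + 1) → ℤ} (hz : z ≠ u) (hzρ : z + ρ ≠ u)
    (hx : x ≠ u) (hxρ : x + ρ ≠ u) (a b : Fib d) : divV (vhSAt ρ d L) u x z a b = 0 := by
  refine divV_vhSAt_eq_zero hL ?_ ?_
  · cases b <;> simpa
  · cases a <;> simpa

/-! ## §5 Consistency with node 8b at `ρ = 0` -/

/-- [folklore] At `ρ = 0` the adapted commutator form IS node 8b's (S-V) `divV_mfNeg_vhS_eq_comm` with the generator
written as an2's `conjV`/`diagK` (`vhSAt_zero`, `linSymAt_zero`, `diagK_legInd_zero`). -/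
theorem divV_mfNeg_vhS_eq_conjV {L : ℕ} (hL : 1 ≤ L) (u : Fin (d + 1) → ℤ) :
    divV (fun κ' v => mfNeg (vhS d L κ' v)) u = conjV (linSym d L) (siteP u) := by
  have h := divV_mfNeg_vhSAt_eq_conjV (d := d) hL 0 u
  simpa only [vhSAt_zero, linSymAt_zero, diagK_legInd_zero] using h

/-- The two leaves agree on the nose: node 8b's own (S-V) `divV_mfNeg_vhS_eq_comm` proves the previous statement by
unfolding `conjV` (definitional cross-check; nothing new). -/
example {L : ℕ} (hL : 1 ≤ L) (u : Fin (d + 1) → ℤ) :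
    divV (fun κ' v => mfNeg (vhS d L κ' v)) u = conjV (linSym d L) (siteP u) := by
  rw [AveragingWardStencils.divV_mfNeg_vhS_eq_comm hL]; rfl

/-- [folklore] At `ρ = 0` the raw entrywise law reduces to node 8b's contact `([z = u] − [x = u]) · mfNeg linSym`. -/
theorem divV_vhS_apply {L : ℕ} (hL : 1 ≤ L) (u x z : Fin (d + 1) → ℤ) (a b : Fib d) :
    divV (vhS d L) u x z a b = ((if z = u then 1 else 0) - (if x = u then 1 else 0)) * mfNeg (linSym d L) x z a b := by
  have h := divV_vhSAt_apply (d := d) hL 0 u x z a b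
  simpa only [vhSAt_zero, linSymAt_zero, legInd_apply, legSite_zero] using h

end

end Summit.QuantumFields.BalabanUV.Beta.AveragingWardRootedStencils
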